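import Summits.AnomalousDissipation.AnomalousDissipation.Theorems.TaylorCertificatesPhantomFloorLawTruncation
import Summits.AnomalousDissipation.AnomalousDissipation.Theorems.TaylorCertificatesPhantomFloorLawBookkeeping
import Summits.AnomalousDissipation.AnomalousDissipation.Theorems.KolmogorovFloor.Negative.Rest
import Literature.Analysis.FluidPDE.NavierStokesConcentrationTools

/-!
# The phantom floor law (`TaylorCertificates.PhantomFloorLaw`, stmt-AnomalousDissipation-14033)

`PhantomFloorLaw_proof : PhantomFloorLaw` — forced standing flows (E∀, `ForcedStandingFlows`) and the packet lemma
(P, `PacketLemma`) imply that NO Taylor-class floor certificate (band-limited cylindrical test fields of degree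
`N ≤ Cν^{-1/2}`, energy weights `θ₁ ∈ [−Θ, 0]`, floor `ε₀` on the finite-enstrophy Leray ball, all small `ν`) exists,
for any force. Paper source: crux workfile `Cruxes/TaylorCertificatePair/PHANTOM-FLOOR.md` §2; the Lean proof
reorganises it (the truncation level is fixed before the viscosity, so only the crude quietness
`ν‖∇P_M v‖² ≤ 4π²νM²‖v‖²` is needed; the floor is tested at `a = P_M v` and at `a ± ŵ` and the last two are ADDED,
so every packet-odd cross term cancels; no dichotomy on the strain). Supports:
`TaylorCertificatesPhantomFloorLaw{Strain,Truncation,Pairing,Bookkeeping}.lean`.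
-/

noncomputable section

-- `Summit.<Summit>.<Sub>` repeats `AnomalousDissipation` by the tree's layout (D-0017), as in the sibling files.
set_option linter.dupNamespace false

open MeasureTheory Filter Topology UnitAddTorus
open scoped InnerProductSpace ENNReal

/-! ## The phantom floor law -/

namespace Summit.AnomalousDissipation.AnomalousDissipation.Theorems

open Literature.Analysis.FunctionSpaces Literature.Analysis.FluidPDE
open Summit.AnomalousDissipation.AnomalousDissipation.Theses.TaylorCertificates
open Summit.AnomalousDissipation.AnomalousDissipation.Theorems.TaylorCertificatePair.Negative
open Summit.AnomalousDissipation.AnomalousDissipation.Theorems.KolmogorovFloor.Negative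
open Summit.AnomalousDissipation.AnomalousDissipation.Theorems.PhantomFloor


/-- **The phantom floor law** (`TaylorCertificates.PhantomFloorLaw`, stmt-AnomalousDissipation-14033):
forced standing flows (E∀) and the packet lemma (P) kill every Taylor-class floor certificate, for every force.

Proof (PHANTOM-FLOOR.md §2, reorganised). Let `f` carry a floor family `(N ≤ Cν^{-1/2}, Φ₁, θ₁ ∈ [−Θ,0])` with
floor `ε₀` on the finite-enstrophy Leray ball, `ν < ν₀`. Take the standing flow `v` of `f` from (E∀) and FIX a
truncation level `M` with `∫‖P_M v − v‖²` small (quantified by the packet price `Π`, `Θ`, `‖v‖`, `‖f‖`); then take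
`ν` small (`νM² ≤ 1`, `ν‖∇P_M v‖² ≤ 4π²νM²‖v‖²` small, `νM‖v‖` small, Leray ball large). At the state `a = P_M v`
put `W = Φ₁'(a)` with strain supremum `s` (attained; the symmetric gradient is trace-free, so some unit `ξ` at
some `x₀` has strain `≤ −s/2`), and let `ŵ` be the packet of (P) at resolution `D₀ = M + N` riding `ξ` at `x₀`:
unit energy, no modes below `2D₀` (so `coords(a ± ŵ) = coords(a)` and `Φ₁'(a ± ŵ) = W`), all modes below `K₁D₀`
(so `(1+2Θ)ν‖∇ŵ‖² ≤ (1+2Θ)4π²K₁²ν(M+N)² ≤ Π`), and `I(ŵ, W) ≤ −s/4`. The floor at `a` reads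
`ε₀ ≤ (1−2θ₁)ν‖∇a‖² + [(f,W) + I(a,W)] + ν(a,ΔW) + 2θ₁(a,f)`; the SUM of the floors at `a + ŵ` and `a − ŵ`
(all `ŵ`-odd cross terms cancel; parallelogram law for the enstrophy) reads the same plus
`(1−2θ₁)ν‖∇ŵ‖² + I(ŵ,W)`. Now `(f,W) + I(a,W) = I(a,W) − I(v,W) ≤ s·r` (Euler identity tested on `W`; polarised
defect of the strain form, `r` small with `‖P_M v − v‖₂`), `|ν(a,ΔW)| ≤ ν‖∇a‖₂‖∇W‖₂ ≤ 13νs‖∇a‖₂` (Green and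
the Korn-type bound `‖∇W‖₂² ≤ 162 s²` for divergence-free `W`), `2θ₁(a,f) ≤ 2Θ|(a − v, f)|` (since `(f,v) ≥ 0`):
the first floor forces `s ≥ 8(Π+1)`, the summed floor forces `s ≤ 8Π`. Contradiction. -/
theorem PhantomFloorLaw_proof : PhantomFloorLaw := by
  intro hE hP
  rintro ⟨f, hfs, hfd, hfz, ε₀, C, Θ, ν₀, hε₀, hν₀, hcert⟩
  have hF2nn : 0 ≤ ∫ x, ‖f x‖ ^ 2 := integral_nonneg fun x => by positivity
  /- Step 0: a vanishing force is excluded by the floor at rest. -/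
  have hF2pos : 0 < ∫ x, ‖f x‖ ^ 2 := by
    refine lt_of_le_of_ne hF2nn fun hF0 => ?_
    obtain ⟨N, Φ₁, θ₁, -, -, -, -, hu⟩ := hcert (ν₀ / 2) (half_pos hν₀) (by linarith only [hν₀])
    have hinj := rest_injects (half_pos hν₀) hu
    have hae := ae_zero_of_integral_sq_zero hfs hF0.symm
    have hzero : (∫ x, ⟪f x, Φ₁.grad 0 x⟫_ℝ) = 0 := by
      rw [← integral_zero (α := (UnitAddTorus (Fin 3))) (G := ℝ)]
      refine integral_congr_ae ?_
      filter_upwards [hae] with x hx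
      simp [hx]
    linarith only [hinj, hzero, hε₀]
  set F2 : ℝ := ∫ x, ‖f x‖ ^ 2 with hF2def
  /- signs of the constants, from the certificate at `ν₀/2` -/
  obtain ⟨N', Φ', θ', hN', -, hθ'a, hθ'b, -⟩ := hcert (ν₀ / 2) (half_pos hν₀) (by linarith only [hν₀])
  have hΘ : 0 ≤ Θ := by linarith only [hθ'a, hθ'b]
  have hC : 0 ≤ C := by
    have hp : 0 < (ν₀ / 2) ^ (-(1 / 2 : ℝ)) := Real.rpow_pos_of_pos (half_pos hν₀) _
    have hN0 : (0 : ℝ) ≤ N' := Nat.cast_nonneg _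
    by_contra hC
    push Not at hC
    have : C * (ν₀ / 2) ^ (-(1 / 2 : ℝ)) < 0 := mul_neg_of_neg_of_pos hC hp
    linarith only [this, hN', hN0]
  /- Step 1: the standing flow of `f`. -/
  obtain ⟨v, hvtop, hvdiv, hvmean, hEuler, hcv⟩ := hE f hfs hfd hfz
  have hv2 : MemLp v 2 volume := hvtop.mono_exponent le_top
  have hvi : Integrable v volume := hv2.integrable one_le_two
  set Ev : ℝ := ∫ x, ‖v x‖ ^ 2 with hEvdef
  have hEv : 0 ≤ Ev := integral_nonneg fun x => by positivity
  obtain ⟨K₁, hK₁⟩ := hP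
  /- constants -/
  set Pw : ℝ := 4 * Real.pi ^ 2 * (K₁ : ℝ) ^ 2 * (2 + 2 * C ^ 2) with hPw
  set PP : ℝ := (1 + 2 * Θ) * Pw with hPP
  have hPw0 : 0 ≤ Pw := by positivity
  have hPP0 : 0 ≤ PP := mul_nonneg (by linarith only [hΘ]) hPw0
  have hPP1 : 0 < PP + 1 := by linarith only [hPP0]
  set ρs : ℝ := min (1 / 8) (ε₀ / (16 * (PP + 1))) with hρs
  have hρs0 : 0 < ρs := lt_min (by norm_num) (div_pos hε₀ (by linarith only [hPP0]))
  have hρs8 : ρs ≤ 1 / 8 := min_le_left _ _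
  have hρsε : ρs ≤ ε₀ / (16 * (PP + 1)) := min_le_right _ _
  have hEv1 : 0 < 4 * (Ev + 1) := by linarith only [hEv]
  set τ : ℝ := ρs / (4 * (Ev + 1)) with hτ
  have hτ0 : 0 < τ := div_pos hρs0 hEv1
  have hτ1 : τ ≤ 1 := by
    rw [hτ, div_le_one hEv1]; linarith only [hρs8, hEv]
  have hτEv : τ * Ev ≤ ρs / 4 :=
    calc τ * Ev ≤ τ * (Ev + 1) := mul_le_mul_of_nonneg_left (by linarith only) hτ0.le
      _ = ρs / 4 := by
          rw [hτ, div_mul_eq_mul_div, mul_div_mul_right _ _ (ne_of_gt (by linarith only [hEv]))]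
  have hsF : 0 ≤ Real.sqrt F2 := Real.sqrt_nonneg _
  have hX0 : 0 ≤ Θ * Real.sqrt F2 := mul_nonneg hΘ hsF
  set e₁ : ℝ := ε₀ / (8 * Θ * Real.sqrt F2 + 1) with he₁
  have he₁0 : 0 < e₁ := div_pos hε₀ (by linarith only [hX0])
  set η2 : ℝ := min (τ * ρs / 8) (e₁ ^ 2) with hη2
  have hη20 : 0 < η2 := lt_min (div_pos (mul_pos hτ0 hρs0) (by norm_num)) (pow_pos he₁0 2)
  have hη2a : η2 ≤ τ * ρs / 8 := min_le_left _ _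
  have hη2b : η2 ≤ e₁ ^ 2 := min_le_right _ _
  /- Step 2: the truncation level `M` and the phantom `a = P_M v`. -/
  obtain ⟨M, hM1, hMclose⟩ := exists_fourierTruncate_close hv2 hη20
  set a : (UnitAddTorus (Fin 3)) → (EuclideanSpace ℝ (Fin 3)) := Torus.fourierTruncate M v with hadef
  have has : Torus.IsSmooth a := Torus.isSmooth_fourierTruncate M v
  have had : Torus.IsDivFree a := Torus.isDivFree_fourierTruncate hv2 hvdiv M
  have ham : Torus.HasZeroMean a := hasZeroMean_fourierTruncate hvi hvmean M
  have haE : ∫ x, ‖a x‖ ^ 2 ≤ Ev := Torus.integral_norm_sq_fourierTruncate_le hv2 M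
  set GaB : ℝ := 4 * Real.pi ^ 2 * (M : ℝ) ^ 2 * Ev with hGaB
  have hGaB0 : 0 ≤ GaB := mul_nonneg (by positivity) hEv
  have hGa : Torus.gradNormSq a ≤ GaB := gradNormSq_fourierTruncate_le hv2 M
  have hGa0 : 0 ≤ Torus.gradNormSq a := Torus.gradNormSq_nonneg a
  set η2' : ℝ := ∫ x, ‖a x - v x‖ ^ 2 with hη2'
  have hη2'0 : 0 ≤ η2' := integral_nonneg fun x => by positivity
  have hh2 : η2' ≤ η2 := hMclose
  /- Step 3: the viscosity. -/
  obtain ⟨ν, hν, hνν₀, hν1, hνM, hνGa, hνLap, hνball⟩ := exists_small_nu hν₀ ((M : ℝ) ^ 2) ((1 + 2 * Θ) * GaB)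
    (13 * Real.sqrt GaB) (Ev + 1) one_pos (by linarith only [hε₀] : (0 : ℝ) < ε₀ / 8) (half_pos hρs0)
    (by linarith only [hF2pos] : (0 : ℝ) < 8 * F2)
  /- Step 4: the certificate at `ν`, the state `a`, the multiplier `W = Φ₁'(a)`. -/
  obtain ⟨N, Φ₁, θ₁, hN, hband, hθ₁, hθ₁', hfloor⟩ := hcert ν hν hνν₀
  have hνN : ν * (N : ℝ) ^ 2 ≤ C ^ 2 := nu_mul_sq_le_sq hν hN
  obtain ⟨A, hA, -⟩ := exists_state_of_smooth_energy has had ham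
  set W : (UnitAddTorus (Fin 3)) → (EuclideanSpace ℝ (Fin 3)) := Φ₁.grad A with hWdef
  have hWs : Torus.IsSmooth W := isSmooth_grad Φ₁ A
  have hWd : Torus.IsDivFree W := isDivFree_grad Φ₁ A
  have hWband : ∀ κ, (N : ℝ) ^ 2 < Torus.freqNormSq κ → mFourierCoeff (EuclideanSpace.complexify ∘ W) κ = 0 :=
    fc_grad_eq_zero Φ₁ hband A
  /- the strain of the multiplier -/
  obtain ⟨s, hs0, hsb, x₀, ξ, hξ, hcomp⟩ := exists_strain_sup hWs hWd
  have hq : ∀ (x : (UnitAddTorus (Fin 3))) (y : (EuclideanSpace ℝ (Fin 3))), |⟪Torus.fderiv W x y, y⟫_ℝ| ≤ s * ‖y‖ ^ 2 := fun x =>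
    quad_bound_of_unit (Torus.fderiv W x) (hsb x)
  have hGW : Torus.gradNormSq W ≤ 162 * s ^ 2 := gradNormSq_le_of_strain hWs hWd hq
  /- Step 5: the packet. -/
  set D₀ : ℕ := M + N with hD₀
  have hD₀1 : 1 ≤ D₀ := hM1.trans (Nat.le_add_right M N)
  have hNd : N ≤ D₀ := Nat.le_add_left N M
  have hWtr : Torus.fourierTruncate D₀ W = W := by
    refine Torus.fourierTruncate_eq_self hWs.continuous fun κ hκ => hWband κ (lt_of_le_of_lt ?_ hκ)
    exact_mod_cast Nat.pow_le_pow_left hNd 2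
  obtain ⟨w, hws, hwd, hwm, hw0, hwK, hwE, hwI⟩ :=
    hK₁ D₀ hD₀1 W hWs hWd hWtr s (fun x η hη => hsb x η hη) x₀ ξ hξ
  have hIw : ∫ x, ⟪Torus.fderiv W x (w x), w x⟫_ℝ ≤ -(s / 4) := by
    have e : ∫ x, ⟪Torus.fderiv W x (w x), w x⟫_ℝ = ∫ x, ⟪w x, Torus.convect w W x⟫_ℝ :=
      integral_congr_ae (ae_of_all _ fun x => real_inner_comm _ _)
    rw [e]
    have hc : ⟪ξ, Torus.convect (fun _ => ξ) W x₀⟫_ℝ ≤ -(s / 2) := hcomp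
    linarith only [hwI, hc]
  have hGw : Torus.gradNormSq w ≤ 4 * Real.pi ^ 2 * ((K₁ * D₀ : ℕ) : ℝ) ^ 2 * ∫ x, ‖w x‖ ^ 2 :=
    gradNormSq_le_of_band_limited hws (band_limited_of_fourierTruncate_eq hwK)
  have hGw0 : 0 ≤ Torus.gradNormSq w := Torus.gradNormSq_nonneg w
  have hνD : ν * ((D₀ : ℕ) : ℝ) ^ 2 ≤ 2 + 2 * C ^ 2 := by
    have e : ((D₀ : ℕ) : ℝ) = (M : ℝ) + N := by rw [hD₀]; push_cast; ring
    rw [e]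
    have h1 : ((M : ℝ) + N) ^ 2 ≤ 2 * (M : ℝ) ^ 2 + 2 * (N : ℝ) ^ 2 := by nlinarith only [sq_nonneg ((M : ℝ) - N)]
    calc ν * ((M : ℝ) + N) ^ 2 ≤ ν * (2 * (M : ℝ) ^ 2 + 2 * (N : ℝ) ^ 2) := mul_le_mul_of_nonneg_left h1 hν.le
      _ = 2 * (ν * (M : ℝ) ^ 2) + 2 * (ν * (N : ℝ) ^ 2) := by ring
      _ ≤ 2 + 2 * C ^ 2 := by linarith only [hνM, hνN]
  have hνGw : ν * Torus.gradNormSq w ≤ Pw := by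
    rw [hwE, mul_one] at hGw
    calc ν * Torus.gradNormSq w ≤ ν * (4 * Real.pi ^ 2 * ((K₁ * D₀ : ℕ) : ℝ) ^ 2) :=
          mul_le_mul_of_nonneg_left hGw hν.le
      _ = 4 * Real.pi ^ 2 * (K₁ : ℝ) ^ 2 * (ν * ((D₀ : ℕ) : ℝ) ^ 2) := by push_cast; ring
      _ ≤ 4 * Real.pi ^ 2 * (K₁ : ℝ) ^ 2 * (2 + 2 * C ^ 2) := mul_le_mul_of_nonneg_left hνD (by positivity)
  /- Step 6: the dressed states `a ± ŵ`; the packet is invisible to the coordinates. -/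
  have horth : ∀ i, ∫ x, ⟪w x, Φ₁.g i x⟫_ℝ = 0 := fun i =>
    integral_inner_eq_zero_of_truncate_eq_zero hws (Φ₁.g_smooth i) (by omega : N ≤ 2 * D₀) hw0
      (fc_g_eq_zero Φ₁ hband i)
  obtain ⟨Up, hUp, -⟩ := exists_state_of_smooth_energy (has.add hws)
    (Torus.IsDivFree.add (has.isContDiff (by simp)) (hws.isContDiff (by simp)) had hwd)
    (Torus.HasZeroMean.add ham hwm has.integrable hws.integrable)
  obtain ⟨Um, hUm, -⟩ := exists_state_of_smooth_energy (has.sub hws) (isDivFree_sub' has hws had hwd)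
    (Torus.HasZeroMean.sub ham hwm has.integrable hws.integrable)
  have hig : ∀ i, Integrable (fun x => ⟪a x, Φ₁.g i x⟫_ℝ) volume := fun i => (has.inner (Φ₁.g_smooth i)).integrable
  have hiw : ∀ i, Integrable (fun x => ⟪w x, Φ₁.g i x⟫_ℝ) volume := fun i => (hws.inner (Φ₁.g_smooth i)).integrable
  have hcUp : Φ₁.coords Up = Φ₁.coords A := by
    ext i
    rw [coords_of_ae hUp, coords_of_ae hA]
    have e : ∫ x, ⟪(a + w) x, Φ₁.g i x⟫_ℝ = (∫ x, ⟪a x, Φ₁.g i x⟫_ℝ) + ∫ x, ⟪w x, Φ₁.g i x⟫_ℝ := by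
      rw [← integral_add (hig i) (hiw i)]
      exact integral_congr_ae (ae_of_all _ fun x => by simp [inner_add_left])
    rw [e, horth i, add_zero]
  have hcUm : Φ₁.coords Um = Φ₁.coords A := by
    ext i
    rw [coords_of_ae hUm, coords_of_ae hA]
    have e : ∫ x, ⟪(a - w) x, Φ₁.g i x⟫_ℝ = (∫ x, ⟪a x, Φ₁.g i x⟫_ℝ) - ∫ x, ⟪w x, Φ₁.g i x⟫_ℝ := by
      rw [← integral_sub (hig i) (hiw i)]
      exact integral_congr_ae (ae_of_all _ fun x => by simp [inner_sub_left])
    rw [e, horth i, sub_zero]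
  have hgUp : Φ₁.grad Up = W := grad_eq_of_coords_eq Φ₁ hcUp
  have hgUm : Φ₁.grad Um = W := grad_eq_of_coords_eq Φ₁ hcUm
  /- Step 7: the three floors. -/
  have hB : 2 * Ev + 2 ≤ 16 * F2 / ν ^ 2 := by
    rw [le_div_iff₀ (pow_pos hν 2)]
    have h1 : ν * (Ev + 1) * ν ≤ 8 * F2 * 1 := mul_le_mul hνball hν1 hν.le (by linarith only [hF2pos])
    have h2 : (2 * Ev + 2) * ν ^ 2 = 2 * (ν * (Ev + 1) * ν) := by ring
    rw [h2]
    linarith only [h1]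
  have hpar := integral_norm_sq_add_add_sub has hws
  have hm0 : 0 ≤ ∫ x, ‖(a - w) x‖ ^ 2 := integral_nonneg fun x => by positivity
  have hp0 : 0 ≤ ∫ x, ‖(a + w) x‖ ^ 2 := integral_nonneg fun x => by positivity
  have hflA0 := hfloor A
  have hflP0 := hfloor Up
  have hflM0 := hfloor Um
  dsimp only at hflA0 hflP0 hflM0
  have hflA := floor_unpack hA has (hflA0 (eGradNormSq_coe_ne_top hA has)
    (by rw [norm_sq_of_ae hA]; linarith only [haE, hB, hEv]))
  have hflP := floor_unpack hUp (has.add hws) (hflP0 (eGradNormSq_coe_ne_top hUp (has.add hws))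
    (by rw [norm_sq_of_ae hUp]; linarith only [hpar, hm0, haE, hB, hwE]))
  have hflM := floor_unpack hUm (has.sub hws) (hflM0 (eGradNormSq_coe_ne_top hUm (has.sub hws))
    (by rw [norm_sq_of_ae hUm]; linarith only [hpar, hp0, haE, hB, hwE]))
  rw [hgUp] at hflP
  rw [hgUm] at hflM
  clear hflA0 hflP0 hflM0
  /- Step 8: bookkeeping. -/
  have hGpm := gradNormSq_add_add_sub has hws
  have hLpm := pairing_add_add_sub has hws hWs.laplacian.continuous
  have hIpm := inertial_pm_sub_eq_zero has hws hWs
  have hPpm := pairing_add_add_sub has hws hfs.continuous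
  have hEul : ∫ x, ⟪Torus.fderiv W x (v x), v x⟫_ℝ = -∫ x, ⟪f x, W x⟫_ℝ :=
    inertial_eq_neg_of_euler hv2 hfs hWs (hEuler W hWs hWd)
  have hdef := inertial_defect_le has hv2 hWs hq hτ0
  -- the defect is small: `τ Ev + τ⁻¹ η₂' + η₂' ≤ ρs/2`
  have hr : τ * Ev + τ⁻¹ * η2' + η2' ≤ ρs / 2 := by
    have h1 : τ⁻¹ * η2' ≤ ρs / 8 := by
      rw [inv_mul_le_iff₀ hτ0]; linarith only [hh2, hη2a]
    have h2 : η2' ≤ ρs / 8 := by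
      have : τ * ρs ≤ 1 * ρs := mul_le_mul_of_nonneg_right hτ1 hρs0.le
      linarith only [hh2, hη2a, this]
    linarith only [hτEv, h1, h2]
  have hX : (∫ x, ⟪f x, W x⟫_ℝ) + ∫ x, ⟪Torus.fderiv W x (a x), a x⟫_ℝ ≤ s * (ρs / 2) := by
    have := mul_le_mul_of_nonneg_left hr hs0
    change (∫ x, ⟪Torus.fderiv W x (a x), a x⟫_ℝ) - ∫ x, ⟪Torus.fderiv W x (v x), v x⟫_ℝ ≤
      s * (τ * Ev + τ⁻¹ * η2' + η2') at hdef
    linarith only [this, hdef, hEul]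
  -- the Laplacian term
  have hY : ν * ∫ x, ⟪a x, Torus.laplacian W x⟫_ℝ ≤ s * (ρs / 2) := by
    have h1 := abs_integral_inner_laplacian_le has hWs
    have h2 : Real.sqrt (Torus.gradNormSq a) ≤ Real.sqrt GaB := Real.sqrt_le_sqrt hGa
    have h3 : Real.sqrt (Torus.gradNormSq W) ≤ 13 * s := by
      refine (Real.sqrt_le_sqrt hGW).trans ?_
      rw [Real.sqrt_le_left (by linarith only [hs0])]
      have e : (13 * s) ^ 2 = 169 * s ^ 2 := by ring
      rw [e]
      linarith only [sq_nonneg s]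
    have h4 : |∫ x, ⟪a x, Torus.laplacian W x⟫_ℝ| ≤ Real.sqrt GaB * (13 * s) :=
      h1.trans (mul_le_mul h2 h3 (Real.sqrt_nonneg _) (Real.sqrt_nonneg _))
    have h5 := (le_abs_self _).trans h4
    have h6 := mul_le_mul_of_nonneg_left h5 hν.le
    have h7 : ν * (Real.sqrt GaB * (13 * s)) = (ν * (13 * Real.sqrt GaB)) * s := by ring
    rw [h7] at h6
    have h8 := mul_le_mul_of_nonneg_right hνLap hs0
    linarith only [h6, h8]
  -- the energy channel: `2θ₁ (a, f) ≤ ε₀/4`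
  have hZ : 2 * θ₁ * ∫ x, ⟪a x, f x⟫_ℝ ≤ ε₀ / 4 := by
    have hvf : Integrable (fun x => ⟪v x, f x⟫_ℝ) volume := Torus.integrable_inner_of_continuous hvi hfs.continuous
    have haf : Integrable (fun x => ⟪a x, f x⟫_ℝ) volume := (has.inner hfs).integrable
    have hPv : 0 ≤ ∫ x, ⟪v x, f x⟫_ℝ := by
      rw [show (∫ x, ⟪v x, f x⟫_ℝ) = ∫ x, ⟪f x, v x⟫_ℝ from integral_congr_ae (ae_of_all _ fun x => real_inner_comm _ _)]
      exact hcv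
    have hsplit : (∫ x, ⟪a x, f x⟫_ℝ) = (∫ x, ⟪v x, f x⟫_ℝ) + ∫ x, ⟪a x - v x, f x⟫_ℝ := by
      rw [← integral_add hvf (haf.sub hvf |>.congr (ae_of_all _ fun x => by simp [inner_sub_left]))]
      exact integral_congr_ae (ae_of_all _ fun x => by simp [inner_sub_left])
    have hPh : |∫ x, ⟪a x - v x, f x⟫_ℝ| ≤ e₁ * Real.sqrt F2 := by
      refine (abs_integral_inner_le ((has.memLp 2).sub hv2) (hfs.memLp 2)).trans ?_
      refine mul_le_mul_of_nonneg_right ?_ (Real.sqrt_nonneg _)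
      rw [Real.sqrt_le_left he₁0.le]
      exact hh2.trans hη2b
    have hkey : 2 * Θ * (e₁ * Real.sqrt F2) ≤ ε₀ / 4 := by
      rw [he₁, show 2 * Θ * (ε₀ / (8 * Θ * Real.sqrt F2 + 1) * Real.sqrt F2) =
        ε₀ * (2 * (Θ * Real.sqrt F2)) / (8 * (Θ * Real.sqrt F2) + 1) by ring]
      rw [div_le_div_iff₀ (by linarith only [hX0]) (by norm_num)]
      nlinarith only [hX0, hε₀.le]
    rw [hsplit, mul_add]
    have hθabs : |θ₁| ≤ Θ := abs_le.2 ⟨by linarith only [hθ₁], hθ₁'.trans hΘ⟩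
    have h1 : 2 * θ₁ * ∫ x, ⟪v x, f x⟫_ℝ ≤ 0 :=
      mul_nonpos_iff.2 (Or.inr ⟨by linarith only [hθ₁'], hPv⟩)
    have h2 : 2 * θ₁ * ∫ x, ⟪a x - v x, f x⟫_ℝ ≤ 2 * Θ * (e₁ * Real.sqrt F2) := by
      have hb : |2 * θ₁ * ∫ x, ⟪a x - v x, f x⟫_ℝ| ≤ 2 * Θ * (e₁ * Real.sqrt F2) := by
        rw [abs_mul, abs_mul, abs_two]
        exact mul_le_mul (mul_le_mul_of_nonneg_left hθabs (by norm_num)) hPh (abs_nonneg _) (by linarith only [hΘ])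
      exact (le_abs_self _).trans hb
    linarith only [h1, h2, hkey]
  /- Step 9: the endgame. -/
  have hGa' : ν * Torus.gradNormSq a - 2 * θ₁ * (ν * Torus.gradNormSq a) ≤ ε₀ / 8 :=
    calc ν * Torus.gradNormSq a - 2 * θ₁ * (ν * Torus.gradNormSq a)
        = (1 - 2 * θ₁) * (ν * Torus.gradNormSq a) := by ring
      _ ≤ (1 + 2 * Θ) * (ν * Torus.gradNormSq a) :=
          mul_le_mul_of_nonneg_right (by linarith only [hθ₁]) (mul_nonneg hν.le hGa0)
      _ ≤ (1 + 2 * Θ) * (ν * GaB) :=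
          mul_le_mul_of_nonneg_left (mul_le_mul_of_nonneg_left hGa hν.le) (by linarith only [hΘ])
      _ = ν * ((1 + 2 * Θ) * GaB) := by ring
      _ ≤ ε₀ / 8 := hνGa
  have hGw' : ν * Torus.gradNormSq w - 2 * θ₁ * (ν * Torus.gradNormSq w) ≤ PP :=
    calc ν * Torus.gradNormSq w - 2 * θ₁ * (ν * Torus.gradNormSq w)
        = (1 - 2 * θ₁) * (ν * Torus.gradNormSq w) := by ring
      _ ≤ (1 + 2 * Θ) * (ν * Torus.gradNormSq w) :=
          mul_le_mul_of_nonneg_right (by linarith only [hθ₁]) (mul_nonneg hν.le hGw0)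
      _ ≤ (1 + 2 * Θ) * Pw := mul_le_mul_of_nonneg_left hνGw (by linarith only [hΘ])
      _ = PP := by rw [hPP]
  rw [← hWdef] at hflA
  -- the floor at `a` forces a large strain
  have hA' : ε₀ / 2 ≤ s * ρs := by linarith only [hflA, hX, hY, hZ, hGa', hε₀]
  -- the summed floor at `a ± ŵ`
  have hGpmν : ν * Torus.gradNormSq (a + w) + ν * Torus.gradNormSq (a - w) =
      2 * (ν * Torus.gradNormSq a) + 2 * (ν * Torus.gradNormSq w) := by rw [← mul_add, hGpm]; ring
  have hGpmθ : θ₁ * (ν * Torus.gradNormSq (a + w)) + θ₁ * (ν * Torus.gradNormSq (a - w)) =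
      2 * (θ₁ * (ν * Torus.gradNormSq a)) + 2 * (θ₁ * (ν * Torus.gradNormSq w)) := by
    rw [← mul_add, ← mul_add, hGpm]; ring
  have hLpmν : ν * (∫ x, ⟪(a + w) x, Torus.laplacian W x⟫_ℝ) + ν * (∫ x, ⟪(a - w) x, Torus.laplacian W x⟫_ℝ) =
      2 * (ν * ∫ x, ⟪a x, Torus.laplacian W x⟫_ℝ) := by rw [← mul_add, hLpm]; ring
  have hPpmθ : θ₁ * (∫ x, ⟪(a + w) x, f x⟫_ℝ) + θ₁ * (∫ x, ⟪(a - w) x, f x⟫_ℝ) =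
      2 * (θ₁ * ∫ x, ⟪a x, f x⟫_ℝ) := by rw [← mul_add, hPpm]; ring
  have hS : ε₀ ≤ (ν * Torus.gradNormSq a - 2 * θ₁ * (ν * Torus.gradNormSq a)) +
      (ν * Torus.gradNormSq w - 2 * θ₁ * (ν * Torus.gradNormSq w)) +
      ((∫ x, ⟪f x, W x⟫_ℝ) + ∫ x, ⟪Torus.fderiv W x (a x), a x⟫_ℝ) +
      ν * (∫ x, ⟪a x, Torus.laplacian W x⟫_ℝ) + (∫ x, ⟪Torus.fderiv W x (w x), w x⟫_ℝ) +
      2 * θ₁ * ∫ x, ⟪a x, f x⟫_ℝ := by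
    linarith only [hflP, hflM, hGpmν, hGpmθ, hLpmν, hIpm, hPpmθ]
  have hs_le : s ≤ 8 * PP := by
    have h1 : s * ρs ≤ s * (1 / 8) := mul_le_mul_of_nonneg_left hρs8 hs0
    linarith only [hS, hGa', hGw', hX, hY, hIw, hZ, h1, hε₀]
  have hs_ge : 8 * (PP + 1) ≤ s := by
    have h2 : s * ρs ≤ s * (ε₀ / (16 * (PP + 1))) := mul_le_mul_of_nonneg_left hρsε hs0
    have h3 : ε₀ / 2 ≤ s * (ε₀ / (16 * (PP + 1))) := hA'.trans h2
    rw [mul_div_assoc', div_le_div_iff₀ (by norm_num) (by linarith only [hPP0])] at h3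
    by_contra h4
    push Not at h4
    have h5 := mul_lt_mul_of_pos_left h4 (by linarith only [hε₀] : (0 : ℝ) < 2 * ε₀)
    linarith only [h3, h5]
  linarith only [hs_le, hs_ge]

end Summit.AnomalousDissipation.AnomalousDissipation.Theorems
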